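import Summits.RiemannHypothesis.RiemannHypothesis.Theorems.ScrewManifestCertWaveChecker
import Summits.RiemannHypothesis.RiemannHypothesis.Theorems.IntegerScrewPivotCriterion
import Summits.RiemannHypothesis.RiemannHypothesis.Theses.ScrewNyquistFloor

/-!
# ScrewManifestCert — part of the integer-screw manifest-certificate development

Batch 3F, last part: `Qf_nonneg_of_cellOK`, `runCells_sound`, `runZero_sound`, the certificate
data, the kernel computation (`decide +kernel` in segments), `dual8WavePos_holds : Dual8WavePos 20`,
`floorAtEight_20`, the bottom line `nyquistFloor_of_D16' : TopBlockD16Works → NyquistFloor`, and the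
RH glue `manifestFamily_imp_rh`.  Importing this module imports the whole development.
(Split of `ScrewManifestCert.lean` v1.5 for the Theorems line cap; overview and file layout in
`Summits.RiemannHypothesis.RiemannHypothesis.Theorems.ScrewManifestCertDefs`.
Nothing in this file bears on the truth of RH.)
-/

set_option linter.dupNamespace false
set_option autoImplicit false

namespace Summit.RiemannHypothesis.RiemannHypothesis.Theorems.IntegerScrew.Manifest

open Literature.NumberTheory.LFunctions Matrix

section Batch3F

open Literature.Analysis.ValidatedNumerics Literature.Analysis.ValidatedNumerics.Numerics Finset

variable {logs : List FI}

/-- A passing cell check `cellOK logs n w` certifies `0 ≤ Q` on the cell `[n/1024, (n+w)/1024]`. -/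
theorem Qf_nonneg_of_cellOK (hL : ∀ n : ℕ, n ≤ 8 → FI.mem (Real.log n) (RungCert.lg logs n))
    (hx : xhiOK logs = true) {n w : ℕ} (h : cellOK logs n w = true) :
    ∀ t, (n : ℝ) / 1024 ≤ t → t ≤ (n : ℝ) / 1024 + (w : ℝ) / 1024 → 0 ≤ Qf t := by
  unfold cellOK at h
  simp only [Bool.and_eq_true, Bool.or_eq_true, decide_eq_true_eq] at h
  obtain ⟨⟨hq0, hend⟩, hcase⟩ := h
  set L := csList logs (ptFI n) with hLdef
  set q := (QEnclL L).lo with hqdef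
  set p := (DEnclL logs L).lo with hpdef
  set m := (DDEnclL logs (inflCS L w)).lo with hmdef
  have hS : (0 : ℝ) < SC := SC_pos
  have hQ : (q : ℝ) ≤ Qf ((n : ℝ) / 1024) * SC := (mem_QEncl hL (mem_ptFI n)).1
  have hP : (p : ℝ) ≤ Qd ((n : ℝ) / 1024) * SC := (mem_DEncl hL (mem_ptFI n)).1
  have hM : ∀ u, (n : ℝ) / 1024 ≤ u → u ≤ (n : ℝ) / 1024 + (w : ℝ) / 1024 → (m : ℝ) ≤ Qdd u * SC := by
    intro u hu1 hu2
    rw [Qdd_eq]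
    exact (mem_DDEnclL hL (fun i hi => (mem_inflCS hL hx n w hu1 hu2 hi).1)
      (fun i hi => (mem_inflCS hL hx n w hu1 hu2 hi).2)).1
  have key := taylor2_bound hasDerivAt_Qf hasDerivAt_Qd (a := (n : ℝ) / 1024) (h := (w : ℝ) / 1024)
    (q := (q : ℝ) / SC) (p := (p : ℝ) / SC) (m := (m : ℝ) / SC)
    (by rw [div_le_iff₀ hS]; exact hQ) (by rw [div_le_iff₀ hS]; exact hP)
    (fun u hu1 hu2 => by rw [div_le_iff₀ hS]; exact hM u hu1 hu2)
  have hq0R : (0 : ℝ) ≤ (q : ℝ) / SC := div_nonneg (by exact_mod_cast hq0) hS.le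
  have hendR : (0 : ℝ) ≤ (q : ℝ) / SC + (p : ℝ) / SC * ((w : ℝ) / 1024)
      + (m : ℝ) / SC / 2 * ((w : ℝ) / 1024 * ((w : ℝ) / 1024)) := by
    have hz : (0 : ℝ) ≤ ((2 * 1024 ^ 2 * q + 2 * 1024 * p * (w : ℤ) + m * (w : ℤ) ^ 2 : ℤ) : ℝ) := by
      exact_mod_cast hend
    have heq : (q : ℝ) / SC + (p : ℝ) / SC * ((w : ℝ) / 1024)
        + (m : ℝ) / SC / 2 * ((w : ℝ) / 1024 * ((w : ℝ) / 1024))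
        = ((2 * 1024 ^ 2 * q + 2 * 1024 * p * (w : ℤ) + m * (w : ℤ) ^ 2 : ℤ) : ℝ) / (2 * 1024 ^ 2 * SC) := by
      push_cast
      field_simp
      ring
    rw [heq]; exact div_nonneg hz (by positivity)
  have hcaseR : (m : ℝ) / SC ≤ 0 ∨ 0 ≤ (p : ℝ) / SC ∨ (m : ℝ) / SC * ((w : ℝ) / 1024) ≤ -((p : ℝ) / SC)
      ∨ (p : ℝ) / SC * ((p : ℝ) / SC) ≤ 2 * ((m : ℝ) / SC) * ((q : ℝ) / SC) := by
    rcases hcase with ((hm | hp) | hturn) | hdisc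
    · left
      have : (m : ℝ) ≤ 0 := by exact_mod_cast hm
      exact div_nonpos_of_nonpos_of_nonneg this hS.le
    · right; left
      exact div_nonneg (by exact_mod_cast hp) hS.le
    · right; right; left
      have hz : (m : ℝ) * (w : ℝ) ≤ -(1024 * (p : ℝ)) := by exact_mod_cast hturn
      have heq : (m : ℝ) / SC * ((w : ℝ) / 1024) + (p : ℝ) / SC
          = ((m : ℝ) * (w : ℝ) + 1024 * (p : ℝ)) / (1024 * SC) := by
        field_simp
      have : (m : ℝ) / SC * ((w : ℝ) / 1024) + (p : ℝ) / SC ≤ 0 := by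
        rw [heq]; exact div_nonpos_of_nonpos_of_nonneg (by linarith) (by positivity)
      linarith
    · right; right; right
      have hz : (p : ℝ) * (p : ℝ) ≤ 2 * (m : ℝ) * (q : ℝ) := by exact_mod_cast hdisc
      have heq : 2 * ((m : ℝ) / SC) * ((q : ℝ) / SC) - (p : ℝ) / SC * ((p : ℝ) / SC)
          = (2 * (m : ℝ) * (q : ℝ) - (p : ℝ) * (p : ℝ)) / (SC * SC) := by
        field_simp
      have : 0 ≤ 2 * ((m : ℝ) / SC) * ((q : ℝ) / SC) - (p : ℝ) / SC * ((p : ℝ) / SC) := by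
        rw [heq]; exact div_nonneg (by linarith) (by positivity)
      linarith
  have hquad := quad_nonneg (h := (w : ℝ) / 1024) (by positivity) hq0R hendR hcaseR
  intro t ht1 ht2
  have h1 := key t ht1 ht2
  have h2 := hquad (t - (n : ℝ) / 1024) (by linarith) (by linarith)
  linarith

/-- Soundness of the adaptive grid run `runCells`: `0 ≤ Q` from `n/1024` to `nEnd/1024`, given
`0 ≤ Q (n/1024)`. -/
theorem runCells_sound (hL : ∀ n : ℕ, n ≤ 8 → FI.mem (Real.log n) (RungCert.lg logs n))
    (hx : xhiOK logs = true) (nEnd : ℕ) :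
    ∀ (ws : List ℕ) (n : ℕ), runCells logs nEnd n ws = true → 0 ≤ Qf ((n : ℝ) / 1024) →
      ∀ t, (n : ℝ) / 1024 ≤ t → t ≤ (nEnd : ℝ) / 1024 → 0 ≤ Qf t
  | [], n, h, h0, t, h1, h2 => by
    have hn : nEnd ≤ n := by simpa [runCells] using h
    have hn' : (nEnd : ℝ) ≤ n := by exact_mod_cast hn
    have ht : t = (n : ℝ) / 1024 := by
      apply le_antisymm _ h1
      exact le_trans h2 (by gcongr)
    rw [ht]; exact h0
  | w :: ws, n, h, h0, t, h1, h2 => by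
    simp only [runCells, Bool.and_eq_true] at h
    obtain ⟨hc, hrest⟩ := h
    have hcell := Qf_nonneg_of_cellOK hL hx hc
    rcases le_or_gt t ((n : ℝ) / 1024 + (w : ℝ) / 1024) with hle | hgt
    · exact hcell t h1 hle
    · have hnw : (((n + w : ℕ) : ℝ)) / 1024 = (n : ℝ) / 1024 + (w : ℝ) / 1024 := by push_cast; ring
      have hseed : 0 ≤ Qf (((n + w : ℕ) : ℝ) / 1024) := by
        rw [hnw]; exact hcell _ (by linarith [show (0 : ℝ) ≤ (w : ℝ) / 1024 by positivity]) le_rfl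
      exact runCells_sound hL hx nEnd ws (n + w) hrest hseed t (by rw [hnw]; exact hgt.le) h2

/-- Soundness of the convexity run `runZero`: `0 ≤ Q″` from `n/1024` to `nEnd/1024`. -/
theorem runZero_sound (hL : ∀ n : ℕ, n ≤ 8 → FI.mem (Real.log n) (RungCert.lg logs n)) (nEnd : ℕ) :
    ∀ (ws : List ℕ) (n : ℕ), runZero logs nEnd n ws = true →
      ∀ u, (n : ℝ) / 1024 ≤ u → u ≤ (nEnd : ℝ) / 1024 → 0 ≤ Qdd u
  | [], n, h, u, h1, h2 => by
    have hn : nEnd < n := by simpa [runZero] using h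
    have hn' : (nEnd : ℝ) < n := by exact_mod_cast hn
    exfalso
    have : (nEnd : ℝ) / 1024 < (n : ℝ) / 1024 := by gcongr
    linarith
  | w :: ws, n, h, u, h1, h2 => by
    simp only [runZero, Bool.and_eq_true, decide_eq_true_eq] at h
    obtain ⟨hc, hrest⟩ := h
    rcases le_or_gt u ((n : ℝ) / 1024 + (w : ℝ) / 1024) with hle | hgt
    · have hm : FI.mem (Qdd u) (DDEncl logs (cellFI n w)) := mem_DDEncl hL (mem_cellFI n w h1 hle)
      have h0 : (0 : ℝ) ≤ Qdd u * SC := le_trans (by exact_mod_cast hc) hm.1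
      exact (mul_nonneg_iff_of_pos_right SC_pos).1 h0
    · have hnw : (((n + w : ℕ) : ℝ)) / 1024 = (n : ℝ) / 1024 + (w : ℝ) / 1024 := by push_cast; ring
      exact runZero_sound hL nEnd ws (n + w) hrest u (by rw [hnw]; exact hgt.le) h2

/-! ### The certificate data and the kernel computation -/

/-- Seven cells of width `3/1024` cover `[0, 21/1024] ⊇ [0, 20/1024]` for the convexity step. -/
def zeroWidths : List ℕ := [3, 3, 3, 3, 3, 3, 3]

/-- The 147 adaptive cell widths (units `1/1024`, from `10/1024` at the primal's active atoms to
`384/1024`) from `20/1024` past `20`, chosen greedily by evaluation (`#eval`) of `cellOK` itself; in three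
segments so that each kernel computation stays short. -/
def cellSeg1 : List ℕ := [16, 24, 32, 40, 48, 56, 64, 64, 80, 80, 96, 96, 112, 112, 128, 128, 128, 128, 128, 112, 112, 96, 96, 80, 80, 64, 56, 48, 40, 32, 28, 20, 16, 14, 12, 16, 24, 32, 40, 56, 64, 80, 96, 112, 128, 160, 160, 192, 224]
/-- Second segment of the adaptive cell widths. -/
def cellSeg2 : List ℕ := [224, 224, 224, 224, 224, 224, 192, 192, 160, 160, 128, 128, 96, 80, 80, 64, 48, 40, 32, 28, 20, 16, 12, 10, 14, 20, 32, 40, 56, 64, 80, 96, 112, 128, 128, 160, 160, 192, 192, 224, 224, 224, 224, 256, 256, 224, 224, 224, 224]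
/-- Third segment of the adaptive cell widths. -/
def cellSeg3 : List ℕ := [224, 192, 224, 224, 256, 256, 256, 320, 320, 320, 320, 256, 224, 192, 160, 128, 96, 64, 48, 32, 16, 12, 32, 80, 128, 192, 256, 320, 320, 384, 384, 320, 256, 256, 224, 160, 128, 112, 96, 112, 160, 192, 256, 256, 320, 320, 256, 224, 160]
/-- All 147 adaptive cell widths, `cellSeg1 ++ (cellSeg2 ++ cellSeg3)`. -/
def cellWidths : List ℕ := cellSeg1 ++ (cellSeg2 ++ cellSeg3)

/-- Grid runs over consecutive width lists concatenate. -/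
theorem runCells_join (logs : List FI) (nEnd : ℕ) : ∀ (ws1 ws2 : List ℕ) (n mid : ℕ),
    mid = n + ws1.sum → runCells logs mid n ws1 = true → runCells logs nEnd mid ws2 = true →
    runCells logs nEnd n (ws1 ++ ws2) = true
  | [], ws2, n, mid, hm, _, h2 => by simp only [List.sum_nil, add_zero] at hm; subst hm; simpa using h2
  | w :: ws1, ws2, n, mid, hm, h1, h2 => by
    simp only [List.sum_cons] at hm
    simp only [runCells, List.cons_append, Bool.and_eq_true] at h1 ⊢
    exact ⟨h1.1, runCells_join logs nEnd ws1 ws2 (n + w) mid (by omega) h1.2 h2⟩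

/-- The four Boolean checks (log table, `xhiOK`, `runZero`, `runCells`) imply `Dual8WavePos 20`. -/
theorem dual8WavePos_of_checks (hok : FI.logTableOK 8 = true) (hx : xhiOK logs8 = true)
    (hz : runZero logs8 20 0 zeroWidths = true) (hc : runCells logs8 20480 20 cellWidths = true) :
    Dual8WavePos 20 := by
  have hL : ∀ n : ℕ, n ≤ 8 → FI.mem (Real.log n) (RungCert.lg logs8 n) :=
    RungCert.logsOK_of_eq rfl hok
  have hdd : ∀ u, 0 ≤ u → u ≤ (20 : ℝ) / 1024 → 0 ≤ Qdd u := fun u hu1 hu2 =>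
    runZero_sound hL 20 zeroWidths 0 hz u (by simpa using hu1) (by simpa using hu2)
  have hsmall : ∀ t, 0 ≤ t → t ≤ (20 : ℝ) / 1024 → 0 ≤ Qf t :=
    nonneg_of_convex_start hasDerivAt_Qf hasDerivAt_Qd (T := 20 / 1024) (by rw [Qf_zero]) (by rw [Qd_zero]) hdd
  have hbig : ∀ t, (20 : ℝ) / 1024 ≤ t → t ≤ 20 → 0 ≤ Qf t := fun t ht1 ht2 => by
    have hseed : 0 ≤ Qf (((20 : ℕ) : ℝ) / 1024) := by
      have := hsmall (20 / 1024) (by norm_num) le_rfl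
      simpa using this
    exact runCells_sound hL hx 20480 cellWidths 20 hc hseed t (by simpa using ht1) (by norm_num; exact ht2)
  intro t ht0 ht20
  rw [frob_waveAtom_y8]
  refine div_nonneg ?_ (by positivity)
  rcases le_or_gt t (20 / 1024) with h | h
  · exact hsmall t ht0.le h
  · exact hbig t h.le ht20

/-- Kernel check: the `M = 8` log table is valid. -/
theorem logTableOK_8 : FI.logTableOK 8 = true := by
  decide +kernel

/-- Kernel check: `xhiOK logs8`. -/
theorem xhiOK_8 : xhiOK logs8 = true := by
  decide +kernel

set_option maxRecDepth 200000 in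
/-- Kernel check: the convexity run on `[0, 21/1024]` passes. -/
theorem runZero_ok : runZero logs8 20 0 zeroWidths = true := by
  decide +kernel

set_option maxRecDepth 200000 in
/-- Kernel check: grid segment 1 (`20/1024 … 3870/1024`) passes. -/
theorem cellSeg1_ok : runCells logs8 3870 20 cellSeg1 = true := by
  decide +kernel

set_option maxRecDepth 200000 in
/-- Kernel check: grid segment 2 (`3870/1024 … 10478/1024`) passes. -/
theorem cellSeg2_ok : runCells logs8 10478 3870 cellSeg2 = true := by
  decide +kernel

set_option maxRecDepth 200000 in
/-- Kernel check: grid segment 3 (`10478/1024 … 20480/1024 = 20`) passes. -/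
theorem cellSeg3_ok : runCells logs8 20480 10478 cellSeg3 = true := by
  decide +kernel

/-- Kernel check: the whole adaptive grid run on `[20/1024, 20]` passes (segments joined). -/
theorem runCells_ok : runCells logs8 20480 20 cellWidths = true :=
  runCells_join _ _ _ _ 20 3870 (by decide) cellSeg1_ok <|
  runCells_join _ _ _ _ 3870 10478 (by decide) cellSeg2_ok cellSeg3_ok

/-- **PROVED (gen16, KERNEL): wave positivity of the `M = 8` dual on `(0, 20]`.** -/
theorem dual8WavePos_holds : Dual8WavePos 20 :=
  dual8WavePos_of_checks logTableOK_8 xhiOK_8 runZero_ok runCells_ok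

/-- **PROVED (gen16, KERNEL): `FloorAtEight 20`** — no manifest certificate of `S_8` with `T ≤ 20`,
any `t_min > 0`. -/
theorem floorAtEight_20 : FloorAtEight 20 := floorAtEight_of_dual8 dual8PairingNeg_holds dual8WavePos_holds

/-- **THE gen16 BOTTOM LINE (final form): `NyquistFloor` follows from the single typed, RH-free,
prime-free first lemma `TopBlockD16Works`.** -/
theorem nyquistFloor_of_D16' (h : TopBlockD16Works) : NyquistFloor :=
  nyquistFloor_of_D16_and_wave8 h dual8WavePos_holds

end Batch3F

/-! ### RH glue (moved here from the head of v1.5: the only declarations that use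
`riemannHypothesis_iff_screwMatrix_posDef`, i.e. that import `Theses.IntegerScrew`) -/

section RHGlue

/-- RH-FREE implication (soundness as a hypothesis; discharged in `manifestFamily_imp_rh` below):
the family statement implies RH, through the tree's `riemannHypothesis_iff_screwMatrix_posDef`
(Suzuki2023 Thm 1.2 on the integer nodes + the route's RH-free detection `DiscreteLandau`). -/
theorem manifestFamily_imp_rh' (hS : ManifestCertSound) {tmin : ℝ} (h : ManifestFamily tmin) :
    _root_.RiemannHypothesis := by
  rw [riemannHypothesis_iff_screwMatrix_posDef]
  intro n
  obtain ⟨T, hT⟩ := h n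
  exact hS n tmin T hT

/-- RH-EQUIVALENCE of the family statement modulo soundness and the tail crux
(soundness discharged in `manifestFamily_iff_rh` below). -/
theorem manifestFamily_iff_rh' (hS : ManifestCertSound) (hTail : TailDDOfRH) {tmin : ℝ}
    (h14 : tmin ≤ 14) : ManifestFamily tmin ↔ _root_.RiemannHypothesis :=
  ⟨fun h => manifestFamily_imp_rh' hS h, fun h => hTail h tmin h14⟩

/-- RH-FREE, PROVED (unconditional form): the family statement implies RH. -/
theorem manifestFamily_imp_rh {tmin : ℝ} (h : ManifestFamily tmin) : _root_.RiemannHypothesis :=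
  manifestFamily_imp_rh' manifestCertSound_proof h

/-- RH-EQUIVALENCE of the family statement modulo the single crux `TailDDOfRH`. -/
theorem manifestFamily_iff_rh (hTail : TailDDOfRH) {tmin : ℝ} (h14 : tmin ≤ 14) :
    ManifestFamily tmin ↔ _root_.RiemannHypothesis :=
  manifestFamily_iff_rh' manifestCertSound_proof hTail h14

end RHGlue


section RouteCloser

/-- **CLOSER of the ASSEMBLY item `stmt-RiemannHypothesis-20032`** (route `ScrewNyquistFloor`):
`TopBlockNeg31 → TopBlockWavePos31 → NyquistFloor`, by `nyquistFloor_of_D16'` — the two route cruxes are by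
definition the conjuncts of `TopBlockD16Works`. [folklore] -/
theorem screwNyquistFloorAssembly_proof :
    Summit.RiemannHypothesis.RiemannHypothesis.Theses.ScrewNyquistFloor.Assembly :=
  fun hneg hpos => nyquistFloor_of_D16' ⟨hneg, hpos⟩

end RouteCloser

end Summit.RiemannHypothesis.RiemannHypothesis.Theorems.IntegerScrew.Manifest
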